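import Summits.QuantumFields.YangMills.Theorems.SqueezedSkewnessTorusKLComplexSpectral
import Summits.QuantumFields.YangMills.Theorems.SqueezedSkewnessTorusKLMixtureAlgebra
import HarnessLib

/-!
# ENGINE-KL layer (K4e-a) for `SqueezedSkewness.TorusKL` (stmt-QuantumFields-23204, stub `stub_torusMixtureData`):
# THE REFERENCE STATES OF THE TORUS KÄLLÉN–LEHMANN MIXTURE

Given the complex spectral package of the `Fin`-torus (`…TorusKLComplexSpectral.exists_complex_spectral_package`: transfer operator `A'`,
translations `U'`, bond operators `X'`, eigenvalue classes `c ∈ C` with joint eigenvectors `e c j` of momentum `q = j.1`), this file builds for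
every reference state `k = (c, j)` the Källén–Lehmann datum of `MixtureAlgebra`: the character-twisted translations
`Ũ_k(γ) = conj χ_q(γ) · U'_{v(γ)}` (a norm-preserving representation of `(ℤ/S)³` fixing `e`), the projected operator
`P_k = c⁻¹ (1−|e⟩⟨e|) A' (1−|e⟩⟨e|)` (self-adjoint, compact, positive, commuting with `Ũ_k`), the diagonal coefficient `γ_k = ⟪e, X'₀ e⟫`
(`= ⟪e, X'_p e⟫` for every site `p`, `|γ_k| ≤ ‖X'₀‖`) and the vector `ψ_k = P_k (X'₀ e − γ_k e)`, and proves the SITE-RESOLVED identity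
`⟪X'_x e, A'^{t+t'} X'_y e⟫ = c^{t+t'} (|γ_k|² + ⟪P_k^{t−1} Ũ_k(x) ψ_k, P_k^{t'−1} Ũ_k(y) ψ_k⟫)` (`t, t' ≥ 1`) — `X'_x e = Ũ_k(x) X'₀ e` by translation
covariance.  Seat `ym-line-fcl-p3` g16; route-independent imports; `[folklore]`; nothing about a summit, NT or the mass gap is proved.
-/

set_option autoImplicit false

noncomputable section

open MeasureTheory Filter Function
open scoped InnerProductSpace ComplexConjugate ENNReal BigOperators
open Literature.MathematicalPhysics.QuantumFieldTheory Literature.Barriers.QuantumFields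
open Literature.Analysis.OperatorTheory
open Summit.QuantumFields.YangMills.Theorems.SqueezedSkewnessJointDiagonal

namespace Summit.QuantumFields.YangMills.Theorems.TorusKL

variable {S : ℕ} [NeZero S] {G : Type*} [Group G] [TopologicalSpace G] [IsTopologicalGroup G] [CompactSpace G] [MeasurableSpace G]
  [BorelSpace G]
set_option maxHeartbeats 400000 in
/-- ★ **Reference states of the torus Källén–Lehmann mixture** (see the module docstring): twisted translations `Ũ_k`, projected operators
`P_k`, diagonal coefficients `γ_k` and vectors `ψ_k` for every joint eigenvector `k = (c, j)` of the complex spectral package, with the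
site-resolved identity `⟪X'_x e, A'^{t+t'} X'_y e⟫ = c^{t+t'} (|γ_k|² + ⟪P_k^{t−1} Ũ_k(x) ψ_k, P_k^{t'−1} Ũ_k(y) ψ_k⟫)`.
[cite: ReedSimonI1980, Thm VI.23] [cite: Luscher1977] -/
theorem exists_reference_states
    {A' : Lp ℂ 2 (Measure.pi fun _ : FinSpatialSite S S S × Fin 3 => haarProbability G) →L[ℂ]
      Lp ℂ 2 (Measure.pi fun _ : FinSpatialSite S S S × Fin 3 => haarProbability G)}
    {U' X' : FinSpatialSite S S S → Lp ℂ 2 (Measure.pi fun _ : FinSpatialSite S S S × Fin 3 => haarProbability G) →L[ℂ]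
      Lp ℂ 2 (Measure.pi fun _ : FinSpatialSite S S S × Fin 3 => haarProbability G)}
    {C : Set ℝ} {d : C → (Fin 3 → ZMod S) → ℕ}
    {e : (c : C) → (Σ q : Fin 3 → ZMod S, Fin (d c q)) → Lp ℂ 2 (Measure.pi fun _ : FinSpatialSite S S S × Fin 3 => haarProbability G)}
    (hA'sa : IsSelfAdjoint A') (hA'c : IsCompactOperator A') (hA'pos : ∀ g, 0 ≤ RCLike.re ⟪A' g, g⟫_ℂ)
    (hU'0 : U' 0 = 1) (hU'add : ∀ v w, U' (v + w) = U' v * U' w) (hU'norm : ∀ v g, ‖U' v g‖ = ‖g‖)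
    (hU'A : ∀ v, A' * U' v = U' v * A') (hX'U : ∀ p v, X' (p + v) * U' v = U' v * X' p)
    (hCpos : ∀ c : C, 0 < (c : ℝ)) (horth : ∀ c, Orthonormal ℂ (e c)) (hAe : ∀ c k, A' (e c k) = ((c : ℝ) : ℂ) • e c k)
    (hUe : ∀ c k (γ : Fin 3 → ZMod S),
      U' ((ZMod.finEquiv S).symm (γ 0), (ZMod.finEquiv S).symm (γ 1), (ZMod.finEquiv S).symm (γ 2)) (e c k) =
        (∏ j, ZMod.stdAddChar (k.1 j * γ j)) • e c k) :
    ∃ (Ut : (Σ c : C, (Σ q : Fin 3 → ZMod S, Fin (d c q))) → (Fin 3 → ZMod S) →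
        Lp ℂ 2 (Measure.pi fun _ : FinSpatialSite S S S × Fin 3 => haarProbability G) →L[ℂ]
          Lp ℂ 2 (Measure.pi fun _ : FinSpatialSite S S S × Fin 3 => haarProbability G))
      (Pk : (Σ c : C, (Σ q : Fin 3 → ZMod S, Fin (d c q))) →
        Lp ℂ 2 (Measure.pi fun _ : FinSpatialSite S S S × Fin 3 => haarProbability G) →L[ℂ]
          Lp ℂ 2 (Measure.pi fun _ : FinSpatialSite S S S × Fin 3 => haarProbability G))
      (γk : (Σ c : C, (Σ q : Fin 3 → ZMod S, Fin (d c q))) → ℂ)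
      (ψk : (Σ c : C, (Σ q : Fin 3 → ZMod S, Fin (d c q))) → Lp ℂ 2 (Measure.pi fun _ : FinSpatialSite S S S × Fin 3 => haarProbability G)),
      (∀ k, IsSelfAdjoint (Pk k) ∧ IsCompactOperator (Pk k) ∧ (∀ v, 0 ≤ RCLike.re ⟪Pk k v, v⟫_ℂ) ∧ Ut k 0 = 1 ∧
        (∀ x y, Ut k (x + y) = Ut k x * Ut k y) ∧ (∀ x v, ‖Ut k x v‖ = ‖v‖) ∧ (∀ x, Pk k * Ut k x = Ut k x * Pk k)) ∧
      (∀ k (p : FinSpatialSite S S S), ⟪e k.1 k.2, X' p (e k.1 k.2)⟫_ℂ = γk k) ∧ (∀ k, ‖γk k‖ ≤ ‖X' 0‖) ∧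
      (∀ k (x y : FinSpatialSite S S S) (t t' : ℕ), 1 ≤ t → 1 ≤ t' →
        ⟪X' x (e k.1 k.2), (A' ^ (t + t')) (X' y (e k.1 k.2))⟫_ℂ =
          (((k.1 : ℝ) : ℂ) ^ (t + t')) * (((‖γk k‖ ^ 2 : ℝ) : ℂ) +
            ⟪(Pk k ^ (t - 1)) (Ut k ![ZMod.finEquiv S x.1, ZMod.finEquiv S x.2.1, ZMod.finEquiv S x.2.2] (ψk k)),
              (Pk k ^ (t' - 1)) (Ut k ![ZMod.finEquiv S y.1, ZMod.finEquiv S y.2.1, ZMod.finEquiv S y.2.2] (ψk k))⟫_ℂ)) := by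
  classical
  -- the bicharacter and the two identifications `(ℤ/S)³ ↔ (Fin S)³`
  obtain ⟨χ, hχ⟩ : ∃ χ : (Fin 3 → ZMod S) → (Fin 3 → ZMod S) → ℂ, χ = fun q γ => ∏ j, ZMod.stdAddChar (q j * γ j) := ⟨_, rfl⟩
  have hχadd : ∀ q γ γ', χ q (γ + γ') = χ q γ * χ q γ' := fun q γ γ' => by rw [hχ]; exact bichar_add q γ γ'
  have hχzero : ∀ q, χ q 0 = 1 := fun q => by rw [hχ]; exact bichar_zero q
  have hχconj : ∀ q γ, conj (χ q γ) = χ q (-γ) := fun q γ => by rw [hχ]; exact bichar_conj q γ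
  have hχnorm : ∀ q γ, ‖χ q γ‖ = 1 := fun q γ => norm_bichar χ hχadd hχzero hχconj q γ
  have hχone : ∀ q γ, conj (χ q γ) * χ q γ = 1 := fun q γ => by
    rw [RCLike.conj_mul, hχnorm]; simp
  obtain ⟨toΓ, htoΓ⟩ : ∃ toΓ : (Fin 3 → ZMod S) → FinSpatialSite S S S, toΓ = fun γ =>
    ((ZMod.finEquiv S).symm (γ 0), (ZMod.finEquiv S).symm (γ 1), (ZMod.finEquiv S).symm (γ 2)) := ⟨_, rfl⟩
  obtain ⟨toZ, htoZ⟩ : ∃ toZ : FinSpatialSite S S S → (Fin 3 → ZMod S), toZ = fun p =>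
    ![ZMod.finEquiv S p.1, ZMod.finEquiv S p.2.1, ZMod.finEquiv S p.2.2] := ⟨_, rfl⟩
  have htoΓ0 : toΓ 0 = 0 := by rw [htoΓ]; simp only [Pi.zero_apply, map_zero]; rfl
  have htoΓadd : ∀ γ γ', toΓ (γ + γ') = toΓ γ + toΓ γ' := fun γ γ' => by rw [htoΓ]; simp only [Pi.add_apply, map_add]; rfl
  have htoΓneg : ∀ γ, toΓ (-γ) = -toΓ γ := fun γ => by
    have h := htoΓadd γ (-γ); rw [add_neg_cancel, htoΓ0] at h
    exact (neg_eq_of_add_eq_zero_right h.symm).symm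
  have htoΓZ : ∀ p, toΓ (toZ p) = p := fun p => by
    rw [htoΓ, htoZ]; simp only [Matrix.cons_val_zero, Matrix.cons_val_one, Matrix.cons_val]
    simp
  have hUeγ : ∀ (c : C) k γ, U' (toΓ γ) (e c k) = χ k.1 γ • e c k := fun c k γ => by rw [htoΓ, hχ]; exact hUe c k γ
  -- reference-state data
  obtain ⟨lamk, hlamk⟩ : ∃ lamk : (Σ c : C, (Σ q : Fin 3 → ZMod S, Fin (d c q))) → ℝ, lamk = fun k => (k.1 : ℝ) := ⟨_, rfl⟩
  obtain ⟨ek, hek⟩ : ∃ ek : (Σ c : C, (Σ q : Fin 3 → ZMod S, Fin (d c q))) →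
      Lp ℂ 2 (Measure.pi fun _ : FinSpatialSite S S S × Fin 3 => haarProbability G), ek = fun k => e k.1 k.2 := ⟨_, rfl⟩
  obtain ⟨Ut, hUt⟩ : ∃ Ut : (Σ c : C, (Σ q : Fin 3 → ZMod S, Fin (d c q))) → (Fin 3 → ZMod S) →
      Lp ℂ 2 (Measure.pi fun _ : FinSpatialSite S S S × Fin 3 => haarProbability G) →L[ℂ]
        Lp ℂ 2 (Measure.pi fun _ : FinSpatialSite S S S × Fin 3 => haarProbability G),
      Ut = fun k γ => conj (χ k.2.1 γ) • U' (toΓ γ) := ⟨_, rfl⟩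
  obtain ⟨Pk, hPk⟩ : ∃ Pk : (Σ c : C, (Σ q : Fin 3 → ZMod S, Fin (d c q))) →
      Lp ℂ 2 (Measure.pi fun _ : FinSpatialSite S S S × Fin 3 => haarProbability G) →L[ℂ]
        Lp ℂ 2 (Measure.pi fun _ : FinSpatialSite S S S × Fin 3 => haarProbability G),
      Pk = fun k => (((lamk k : ℝ) : ℂ)⁻¹) •
        ((1 - (innerSL ℂ (ek k)).smulRight (ek k)) * A' * (1 - (innerSL ℂ (ek k)).smulRight (ek k))) := ⟨_, rfl⟩
  obtain ⟨γk, hγk⟩ : ∃ γk : (Σ c : C, (Σ q : Fin 3 → ZMod S, Fin (d c q))) → ℂ, γk = fun k => ⟪ek k, X' 0 (ek k)⟫_ℂ := ⟨_, rfl⟩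
  obtain ⟨ψk, hψk⟩ : ∃ ψk : (Σ c : C, (Σ q : Fin 3 → ZMod S, Fin (d c q))) →
      Lp ℂ 2 (Measure.pi fun _ : FinSpatialSite S S S × Fin 3 => haarProbability G),
      ψk = fun k => Pk k (X' 0 (ek k) - γk k • ek k) := ⟨_, rfl⟩
  have hlampos : ∀ k, 0 < lamk k := fun k => by rw [hlamk]; exact hCpos k.1
  have he1 : ∀ k, ‖ek k‖ = 1 := fun k => by rw [hek]; exact (horth k.1).1 k.2
  have hAek : ∀ k, A' (ek k) = ((lamk k : ℝ) : ℂ) • ek k := fun k => by rw [hek, hlamk]; exact hAe k.1 k.2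
  -- the twisted translations
  have hUt0 : ∀ k, Ut k 0 = 1 := fun k => by rw [hUt]; simp only [hχzero, map_one, one_smul, htoΓ0, hU'0]
  have hUtadd : ∀ k x y, Ut k (x + y) = Ut k x * Ut k y := fun k x y => by
    rw [hUt]; simp only [hχadd, map_mul, htoΓadd, hU'add, smul_mul_smul_comm]
  have hUtnorm : ∀ k x v, ‖Ut k x v‖ = ‖v‖ := fun k x v => by
    rw [hUt]; simp only [_root_.smul_apply, norm_smul, RCLike.norm_conj, hχnorm, one_mul, hU'norm]
  have hUte : ∀ k γ, Ut k γ (ek k) = ek k := fun k γ => by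
    rw [hUt, hek]; simp only [_root_.smul_apply]
    rw [hUeγ, smul_smul, hχone, one_smul]
  have hUtA : ∀ k γ, A' * Ut k γ = Ut k γ * A' := fun k γ => by
    rw [hUt]; simp only [mul_smul_comm, smul_mul_assoc, hU'A]
  have hUtinner : ∀ k γ v, ⟪ek k, Ut k γ v⟫_ℂ = ⟪ek k, v⟫_ℂ := fun k =>
    MixtureAlgebra.inner_rep_fixed (Ut k) (hUt0 k) (hUtadd k) (hUtnorm k) (hUte k)
  -- the projected operators
  have hP : ∀ k, IsSelfAdjoint (Pk k) ∧ IsCompactOperator (Pk k) ∧ (∀ v, 0 ≤ RCLike.re ⟪Pk k v, v⟫_ℂ) ∧ Pk k (ek k) = 0 ∧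
      (∀ v, ⟪ek k, v⟫_ℂ = 0 → Pk k v = (((lamk k : ℝ) : ℂ)⁻¹) • A' v) ∧ (∀ v, ⟪ek k, v⟫_ℂ = 0 → ⟪ek k, Pk k v⟫_ℂ = 0) ∧
      (∀ W : Lp ℂ 2 (Measure.pi fun _ : FinSpatialSite S S S × Fin 3 => haarProbability G) →L[ℂ]
        Lp ℂ 2 (Measure.pi fun _ : FinSpatialSite S S S × Fin 3 => haarProbability G),
        W (ek k) = ek k → (∀ v, ⟪ek k, W v⟫_ℂ = ⟪ek k, v⟫_ℂ) → A' * W = W * A' → Pk k * W = W * Pk k) := fun k => by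
    rw [hPk]; exact MixtureAlgebra.projected_props hA'sa hA'c hA'pos (he1 k) (hAek k) (hlampos k)
  have hPUt : ∀ k γ, Pk k * Ut k γ = Ut k γ * Pk k := fun k γ => (hP k).2.2.2.2.2.2 (Ut k γ) (hUte k γ) (hUtinner k γ) (hUtA k γ)
  -- the bond operator applied to a reference state is a twisted translate of `ξ = X'₀ e`
  have hXe : ∀ k γ, X' (toΓ γ) (ek k) = Ut k γ (X' 0 (ek k)) := fun k γ => by
    have h1 : ek k = U' (toΓ γ) (U' (toΓ (-γ)) (ek k)) := by
      rw [← mul_apply_eq_comp, ← hU'add, ← htoΓadd, add_neg_cancel, htoΓ0, hU'0, one_apply_eq_self]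
    have h2 : ∀ v, X' (toΓ γ) (U' (toΓ γ) v) = U' (toΓ γ) (X' 0 v) := fun v => by
      rw [← mul_apply_eq_comp, ← mul_apply_eq_comp, ← hX'U 0 (toΓ γ), zero_add]
    conv_lhs => rw [h1]
    rw [h2, hek]
    simp only
    rw [hUeγ, map_smul, map_smul, hUt]
    simp only [_root_.smul_apply, hχconj]
  -- ★ the per-reference-state mixture identity
  have hmix : ∀ k (γ γ' : Fin 3 → ZMod S) {t t' : ℕ}, 1 ≤ t → 1 ≤ t' →
      ⟪X' (toΓ γ) (ek k), (A' ^ (t + t')) (X' (toΓ γ') (ek k))⟫_ℂ =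
        (((lamk k : ℝ) : ℂ) ^ (t + t')) * (((‖γk k‖ ^ 2 : ℝ) : ℂ) +
          ⟪(Pk k ^ (t - 1)) (Ut k γ (ψk k)), (Pk k ^ (t' - 1)) (Ut k γ' (ψk k))⟫_ℂ) := by
    intro k γ γ' t t' ht ht'
    rw [hXe, hXe, hψk, hγk]
    exact MixtureAlgebra.inner_pow_mixture hA'sa (he1 k) (hAek k) (hlampos k) (Ut k) (hUt0 k) (hUtadd k) (hUtnorm k) (hUte k)
      (hUtA k) (hP k).1 (hP k).2.2.2.2.1 (hPUt k) (X' 0 (ek k)) γ γ' ht ht'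
  -- the diagonal coefficient is translation independent and bounded
  have hdiag : ∀ k (p : FinSpatialSite S S S), ⟪ek k, X' p (ek k)⟫_ℂ = γk k := fun k p => by
    rw [hγk, ← htoΓZ p, hXe, hUtinner]
  have hγbd : ∀ k, ‖γk k‖ ≤ ‖X' 0‖ := fun k => by
    rw [hγk]
    calc ‖⟪ek k, X' 0 (ek k)⟫_ℂ‖ ≤ ‖ek k‖ * ‖X' 0 (ek k)‖ := norm_inner_le_norm _ _
      _ ≤ ‖ek k‖ * (‖X' 0‖ * ‖ek k‖) := mul_le_mul_of_nonneg_left (ContinuousLinearMap.le_opNorm _ _) (norm_nonneg _)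
      _ = ‖X' 0‖ := by rw [he1]; ring
  refine ⟨Ut, Pk, γk, ψk, fun k => ⟨(hP k).1, (hP k).2.1, (hP k).2.2.1, hUt0 k, hUtadd k, hUtnorm k, hPUt k⟩,
    fun k p => by rw [← hdiag k p, hek], hγbd, fun k x y t t' ht ht' => ?_⟩
  have hm := hmix k (toZ x) (toZ y) ht ht'
  rw [htoΓZ, htoΓZ, hek, hlamk] at hm
  rw [hm, htoZ]

end Summit.QuantumFields.YangMills.Theorems.TorusKL

end
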